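import Literature.NumberTheory.LFunctions.VinogradovKorobovTrigIntegral
import Literature.NumberTheory.LFunctions.ZetaLogDerivRealBound
import Literature.NumberTheory.LFunctions.VinogradovKorobovInputsProofs
import HarnessLib

/-!
# Zeros of `ζ` near `1 + it`: MTY Lemma 4.5 / Ford Lemma 4.2 from Ford's zero detector Lemma 4.1

Topic `Literature/NumberTheory/LFunctions`. Everything here is PROVED; the two analytic inputs enter
as explicit hypotheses (no named fact is introduced):

* `FordLemma41 A B` — the conclusion of **Ford 2002, Lemma 4.1** (= MTY Lemma 4.1; Ford's zero
  detector Lemma 2.2 for `f = ζ` at `z₀ = s`, with (3.1) inserted on the line `Re = σ − η` through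
  Lemma 3.4): for `σ − η ≥ 1/2`, `1 ≤ σ ≤ 1 + η`, `t ≥ 100` and a finite set `S` of zeros with
  `Re ρ ≥ σ − η` (multiplicities `m(ρ)`),
  `−Re ζ'/ζ(s) ≤ −Σ_{ρ∈S} m(ρ) Re (π/2η) cot(π(s−ρ)/2η) + (1/2η)[(2/3) log log t
   + B(1−σ+η)^{3/2} log t + log A] − (1/4η) ∫ log|ζ(s+η+2ηiu/π)|/cosh²u du`;
* Ford's **(4.2)**: `Re (π/5) cot(πz/5) ≥ 0.3758` on `U = {Re z ≥ 0.6421, |z − 0.6421| ≤ 1}`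
  ("verified by a short computation using Maple"; the minimum on `∂U` is `0.375808…`).

From these, `mty_lemma_4_5_of_ford41`: **for `t ≥ 100`, `0 < R ≤ 1/4`,
`N(t, R) ≤ 1.3478 R^{3/2} B log t + 3.777 + (log A − log R + (2/3) log log t)/1.879`.**

## The constant: `3.777`, not the printed `0.49` (Ford) / `0.479` (MTY)

Ford's proof of Lemma 4.2 (arXiv:1910.08205, p. 7; repeated in Khale, arXiv:2210.06457, Lemma 6.3,
and in MTY, proof of Lemma 4.5, (4.10)): "Apply Lemma 4.1 with `s = 1 + 0.6421R + it`,
`η = 2.5R` … By Lemma 3.1, `|ζ'/ζ(s+η+iv)| ≤ 1/(3.1421R)`, `|ζ(s+η+iv)|⁻¹ ≤ ζ(1+3.1421R)` (4.1) …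
Therefore, by (4.1), (4.2) and Lemma 4.1, `−1/(3.1421R) ≤ −0.3758 N(t,R)/R + (1/5R)(…)`", whence
`0.49 = (1/0.3758)(1/3.1421 − 0.6735/5)` (MTY: `0.479 = (1/0.3758)(1/3.1421 − 0.6914/5)` with
Ramaré's bound). But the left-hand side of Lemma 4.1 is `−Re ζ'/ζ(s)` at `Re s = 1 + 0.6421R`,
where Lemma 3.1 gives only `|ζ'/ζ(s)| < 1/(0.6421R)`; the bound (4.1a) is on the line
`Re = 1 + 3.1421R`, the abscissa of the log-integral, and is not available for the left-hand side
(indeed `sup_t Re ζ'/ζ(σ+it) = Σ_p log p/(p^σ + 1)`, about `4.3` at `σ = 1.16`, `R = ¼`, whereas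
`1/(3.1421R) = 1.27`). What Ford's argument proves is the lemma with
`(1/0.3758)(1/0.6421 − 0.6903/5) = 3.7768… ≤ 3.777` (with MTY's Ramaré constant, here `0.6903`
from `γ < 0.577216` and `log 3.1421 > 1.1443`); this is the statement proved below. The printed
statements may still be true; this file does not decide that.

## Proof (Ford, proof of Lemma 4.2, with the honest constant)

`σ = 1 + 0.6421R`, `η = 2.5R`, `S` = the zeros of the closed disc `|1+it−ρ| ≤ R` (they have
`Re ρ ≥ 1 − R ≥ σ − η`): the left side is `≥ −1/(0.6421R)` (`norm_deriv_riemannZeta_div_lt`,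
`ZetaLogDerivRealBound.lean`); for `ρ` in the disc, `z = (s − ρ)/R ∈ U` and
`(π/2η) cot(π(s−ρ)/2η) = R⁻¹ (π/5) cot(πz/5)`, so the cot-sum is `≥ 0.3758 N(t,R)/R`; the
log-integral is `≥ −2 log ζ(1 + 3.1421R)` (`|ζ(s')| ≥ ζ(2σ')/ζ(σ') ≥ 1/ζ(σ')`,
`ZetaEulerLowerBound.lean`, `∫ sech² = 2`), and `log ζ(1 + 3.1421R) ≤ 3.1421γR − log(3.1421R)
≤ −log R − 0.6903` (Ramaré's (3.2), `zeta_real_le_ramare_holds`).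

## References

* K. Ford, *Zero-free regions for the Riemann zeta function* (2002) = arXiv:1910.08205, Lemmas
  3.1, 4.1, 4.2 and (4.1)–(4.2). (`Ford2002Millennium`)
* M. J. Mossinghoff, T. S. Trudgian, A. Yang, arXiv:2212.06867, Lemma 4.5 and (4.10).
  (`MossinghoffTrudgianYangRNT2024`)
-/

noncomputable section

open Complex Real MeasureTheory Finset Set Filter
open scoped Topology

namespace Literature.NumberTheory.LFunctions

/-- **Ford 2002, Lemma 4.1 (zero detector for `ζ` with (3.1) inserted)** as a predicate on the
constants `A`, `B` of (3.1): for `η > 0`, `σ − η ≥ 1/2`, `1 ≤ σ ≤ 1 + η`, `t ≥ 100` and every finite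
set `S` of zeros `ρ` of `ζ` with `Re ρ ≥ σ − η` (multiplicities `m(ρ) = riemannZetaZeroOrder ρ`),
`−Re ζ'/ζ(σ+it) ≤ −Σ_{ρ∈S} m(ρ) Re{(π/2η) cot((π/2η)(σ+it−ρ))}`
`+ (1/2η)[(2/3) log log t + B(1−σ+η)^{3/2} log t + log A] − (1/4η) ∫ log|ζ(σ+η+i(t+2ηu/π))|/cosh²u du`.
Users take `(h : FordLemma41 A B)`; it follows from Ford's Lemma 2.2, Lemma 3.4 and (3.1).
[cite: Ford2002Millennium, Lemma 4.1] -/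
def FordLemma41 (A B : ℝ) : Prop :=
  ∀ σ t η : ℝ, 0 < η → 1 / 2 ≤ σ - η → 1 ≤ σ → σ ≤ 1 + η → 100 ≤ t →
    ∀ S : Finset ℂ, (∀ ρ ∈ S, riemannZeta ρ = 0 ∧ σ - η ≤ ρ.re) →
      -(deriv riemannZeta (σ + t * I) / riemannZeta (σ + t * I)).re ≤
        -(∑ ρ ∈ S, (riemannZetaZeroOrder ρ : ℝ) *
            ((((π / (2 * η) : ℝ) : ℂ) * Complex.cot (((π / (2 * η) : ℝ) : ℂ) * (σ + t * I - ρ))).re))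
        + 1 / (2 * η) * (2 / 3 * Real.log (Real.log t) + B * (1 - σ + η) ^ (3 / 2 : ℝ) * Real.log t
            + Real.log A)
        - 1 / (4 * η) * fordLogZetaIntegral (σ + η) t (2 * η / π)

namespace NearZeroCount

/-- `1 ≤ Re ζ(x)` for real `x > 1` (the first term of the Dirichlet series). [folklore] -/
theorem one_le_re_zeta {x : ℝ} (hx : 1 < x) : 1 ≤ (riemannZeta x).re := by
  have hx' : 1 < (x : ℂ).re := by simpa using hx
  have hsum : Summable fun n : ℕ ↦ 1 / ((n : ℂ) + 1) ^ (x : ℂ) := by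
    have := (Complex.summable_one_div_nat_cpow (p := (x : ℂ))).2 hx'
    rw [← summable_nat_add_iff 1] at this
    simpa using this
  have hterm : ∀ n : ℕ, (1 / ((n : ℂ) + 1) ^ (x : ℂ)) = ((((n : ℝ) + 1) ^ x)⁻¹ : ℝ) := by
    intro n
    have : ((n : ℂ) + 1) = (((n : ℝ) + 1 : ℝ) : ℂ) := by push_cast; ring
    rw [this, ← Complex.ofReal_cpow (by positivity), one_div, Complex.ofReal_inv]
  rw [zeta_eq_tsum_one_div_nat_add_one_cpow hx', Complex.re_tsum hsum]
  simp_rw [hterm, Complex.ofReal_re]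
  have hsum' : Summable fun n : ℕ ↦ (((n : ℝ) + 1) ^ x)⁻¹ := by
    have := Complex.reCLM.summable hsum
    refine this.congr fun n ↦ ?_
    simp [hterm]
  have h0 : (((0 : ℕ) : ℝ) + 1) ^ x = 1 := by simp
  calc (1 : ℝ) = (((0 : ℕ) : ℝ) + 1) ^ x := by rw [h0]
    _ = ((((0 : ℕ) : ℝ) + 1) ^ x)⁻¹ := by rw [h0]; norm_num
    _ ≤ ∑' n : ℕ, (((n : ℝ) + 1) ^ x)⁻¹ :=
        hsum'.le_tsum 0 fun n _ ↦ by positivity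

/-- `log|ζ(σ' + iy)| ≥ −log ζ(σ')` for `σ' > 1` (`|ζ(s)| ≥ ζ(2σ')/ζ(σ') ≥ 1/ζ(σ')`; Ford's Lemma
3.1, first inequality). [cite: Ford2002Millennium, Lemma 3.1] -/
theorem neg_log_zeta_le_log_norm {σ' : ℝ} (hσ : 1 < σ') (y : ℝ) :
    -Real.log ((riemannZeta σ').re) ≤ Real.log ‖riemannZeta ((σ' : ℂ) + (y : ℂ) * I)‖ := by
  set s : ℂ := (σ' : ℂ) + (y : ℂ) * I with hs
  have hsre : s.re = σ' := by simp [hs]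
  have hs1 : 1 < s.re := by rw [hsre]; exact hσ
  have hζs : riemannZeta s ≠ 0 := riemannZeta_ne_zero_of_one_lt_re hs1
  have h := norm_inv_riemannZeta_le_div hs1
  rw [hsre] at h
  have h1 : 1 ≤ ‖riemannZeta ((2 * σ' : ℝ) : ℂ)‖ := by
    have := one_le_re_zeta (show 1 < 2 * σ' by linarith)
    exact this.trans (Complex.re_le_norm _)
  have hZ : 0 < (riemannZeta σ').re := by linarith [one_le_re_zeta hσ]
  have hZn : ‖riemannZeta (σ' : ℂ)‖ = (riemannZeta σ').re := (FordTrig.re_zeta_eq_norm hσ).symm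
  have h2 : ‖(riemannZeta s)⁻¹‖ ≤ (riemannZeta σ').re := by
    refine h.trans ?_
    rw [hZn, div_le_iff₀ (by linarith)]
    nlinarith
  rw [norm_inv] at h2
  have hpos : 0 < ‖riemannZeta s‖ := norm_pos_iff.2 hζs
  rw [inv_le_comm₀ hpos hZ] at h2
  have := Real.log_le_log (inv_pos.2 hZ) h2
  rwa [Real.log_inv] at this

/-- The log-integral on `Re = σ' > 1` is `≥ −2 log ζ(σ')`. [cite: Ford2002Millennium, Lemma 3.1 and proof of Lemma 4.2] -/
theorem fordLogZetaIntegral_ge {σ' : ℝ} (hσ : 1 < σ') (τ κ : ℝ) :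
    -2 * Real.log ((riemannZeta σ').re) ≤ fordLogZetaIntegral σ' τ κ := by
  unfold fordLogZetaIntegral
  have hint := FordTrig.integrable_log_norm_zeta_line hσ τ κ
  have hint0 : Integrable fun u : ℝ ↦ (-Real.log ((riemannZeta σ').re)) * (1 / Real.cosh u ^ 2) :=
    (Literature.Analysis.SpecialFunctions.integrable_inv_cosh_sq).const_mul _
  have hmono := integral_mono hint0 hint fun u ↦ ?_
  · have e : ∫ u : ℝ, (-Real.log ((riemannZeta σ').re)) * (1 / Real.cosh u ^ 2)
        = -2 * Real.log ((riemannZeta σ').re) := by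
      rw [integral_const_mul, Literature.Analysis.SpecialFunctions.integral_inv_cosh_sq]; ring
    rw [e] at hmono
    exact hmono
  · simp only
    rw [show (-Real.log ((riemannZeta σ').re)) * (1 / Real.cosh u ^ 2)
        = (-Real.log ((riemannZeta σ').re)) / Real.cosh u ^ 2 by ring]
    exact div_le_div_of_nonneg_right (neg_log_zeta_le_log_norm hσ _) (by positivity)

/-- `log ζ(1 + 3.1421R) ≤ −log R − 0.6903` for `0 < R ≤ 1/4` (Ramaré's (3.2): `ζ(σ) ≤ e^{γ(σ−1)}/(σ−1)`;
MTY (4.10) prints `0.6914`, using `log 3.1421 = 1.14489…`; here `log 3.1421 > 1.1443`).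
[cite: MossinghoffTrudgianYangRNT2024, (3.2) and (4.10)] -/
theorem log_zeta_ramare_bound {R : ℝ} (hR : 0 < R) (hR4 : R ≤ 1 / 4) :
    Real.log ((riemannZeta ((1 + 3.1421 * R : ℝ) : ℂ)).re) ≤ -Real.log R - 0.6903 := by
  have hσ : 1 < 1 + 3.1421 * R := by linarith
  have hram := zeta_real_le_ramare_holds (1 + 3.1421 * R) hσ
  have hZ : 0 < (riemannZeta ((1 + 3.1421 * R : ℝ) : ℂ)).re := by linarith [one_le_re_zeta hσ]
  have e1 : 1 + 3.1421 * R - 1 = 3.1421 * R := by ring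
  rw [e1] at hram
  have h1 := Real.log_le_log hZ hram
  rw [Real.log_div (Real.exp_pos _).ne' (by positivity), Real.log_exp,
    Real.log_mul (by norm_num) hR.ne'] at h1
  have hγ := Literature.Analysis.SpecialFunctions.Real.eulerMascheroniConstant_lt_d8
  have hγ0 : 0 < Real.eulerMascheroniConstant := by
    linarith [Literature.Analysis.SpecialFunctions.Real.eulerMascheroniConstant_gt_d8]
  -- `log 3.1421 > 1.1443`: `3.1421 = e · (3.1421/e)`, `3.1421/e > 1.1559139`, and the cubic Taylor bound
  have hlog : (1.1443 : ℝ) ≤ Real.log 3.1421 := by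
    have he := Real.exp_one_lt_d9
    have he0 := Real.exp_pos (1 : ℝ)
    have hq : (1.1559139 : ℝ) ≤ 3.1421 / Real.exp 1 := by
      rw [le_div_iff₀ he0]; nlinarith
    have hy : (0.1443 : ℝ) ≤ Real.log 1.1559139 := by
      have h := Real.abs_log_sub_add_sum_range_le (x := (-0.1559139 : ℝ)) (by norm_num) 3
      simp only [Finset.sum_range_succ, Finset.sum_range_zero] at h
      norm_num at h
      rw [abs_le] at h
      linarith [h.1, h.2]
    have h3 : Real.log 3.1421 = 1 + Real.log (3.1421 / Real.exp 1) := by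
      rw [Real.log_div (by norm_num) he0.ne', Real.log_exp]; ring
    rw [h3]
    have := Real.log_le_log (by norm_num) hq
    linarith
  nlinarith [hγ, hγ0, hlog, hR]

end NearZeroCount

open NearZeroCount

set_option maxHeartbeats 800000 in
/-- **MTY Lemma 4.5 / Ford Lemma 4.2 with the constant that Ford's argument yields**: from
`FordLemma41 A B` (Ford's Lemma 4.1) and Ford's (4.2) (`Re (π/5)cot(πz/5) ≥ 0.3758` on
`U = {Re z ≥ 0.6421, |z − 0.6421| ≤ 1}`), for `t ≥ 100` and `0 < R ≤ 1/4`,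
`N(t,R) ≤ 1.3478 R^{3/2} B log t + 3.777 + (log A − log R + (2/3) log log t)/1.879` (the printed
constant is `0.479`; see the module docstring). [cite: MossinghoffTrudgianYangRNT2024, Lemma 4.5]
[cite: Ford2002Millennium, Lemma 4.2] -/
theorem mty_lemma_4_5_of_ford41 {A B : ℝ} (hB : 0 ≤ B) (h41 : FordLemma41 A B)
    (hcot : ∀ z : ℂ, 0.6421 ≤ z.re → ‖z - 0.6421‖ ≤ 1 →
      0.3758 ≤ (((π / 5 : ℝ) : ℂ) * Complex.cot (((π / 5 : ℝ) : ℂ) * z)).re)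
    {t R : ℝ} (ht : 100 ≤ t) (hR : 0 < R) (hR4 : R ≤ 1 / 4) :
    fordN t R ≤ 1.3478 * R ^ (3 / 2 : ℝ) * B * Real.log t + 3.777
      + (Real.log A - Real.log R + 2 / 3 * Real.log (Real.log t)) / 1.879 := by
  classical
  set σ : ℝ := 1 + 0.6421 * R with hσ
  set η : ℝ := 5 / 2 * R with hη
  have hη0 : 0 < η := by positivity
  have hRpos := hR
  -- the disc zeros qualify
  have hmem : ∀ ρ ∈ fordNearZeros t R, riemannZeta ρ = 0 ∧ σ - η ≤ ρ.re := by
    intro ρ hρ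
    rw [mem_fordNearZeros] at hρ
    have hre := Complex.abs_re_le_norm (1 + t * I - ρ)
    simp only [Complex.sub_re, Complex.add_re, Complex.one_re, Complex.mul_re, Complex.ofReal_re,
      Complex.I_re, mul_zero, Complex.ofReal_im, Complex.I_im, mul_one, sub_self, add_zero] at hre
    rw [abs_le] at hre
    refine ⟨hρ.1, ?_⟩
    rw [hσ, hη]; linarith [hre.1, hre.2, hρ.2]
  have h := h41 σ t η hη0 (by rw [hσ, hη]; linarith) (by rw [hσ]; linarith) (by rw [hσ, hη]; linarith)
    ht (fordNearZeros t R) hmem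
  -- (i) the left side `≥ −1/(0.6421R)`
  have hlhs : -(1 / (0.6421 * R)) ≤ -(deriv riemannZeta (σ + t * I) / riemannZeta (σ + t * I)).re := by
    have hs : 1 < ((σ : ℂ) + t * I).re := by simp [hσ]; positivity
    have h1 := norm_deriv_riemannZeta_div_lt hs
    have e : ((σ : ℂ) + t * I).re - 1 = 0.6421 * R := by simp [hσ]
    rw [e] at h1
    have h2 := Complex.re_le_norm (deriv riemannZeta (σ + t * I) / riemannZeta (σ + t * I))
    linarith
  -- (ii) the cot terms are `≥ 0.3758/R` on the disc
  have hcotρ : ∀ ρ ∈ fordNearZeros t R,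
      0.3758 / R ≤ ((((π / (2 * η) : ℝ) : ℂ) * Complex.cot (((π / (2 * η) : ℝ) : ℂ) * (σ + t * I - ρ))).re) := by
    intro ρ hρ
    rw [mem_fordNearZeros] at hρ
    have hre1 : ρ.re < 1 := by
      by_contra hle
      exact riemannZeta_ne_zero_of_one_le_re (not_lt.1 hle) hρ.1
    set z : ℂ := ((σ : ℂ) + t * I - ρ) / (R : ℂ) with hz
    have hRC : (R : ℂ) ≠ 0 := by exact_mod_cast hR.ne'
    have ecoef : ((π / (2 * η) : ℝ) : ℂ) = ((1 / R : ℝ) : ℂ) * ((π / 5 : ℝ) : ℂ) := by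
      rw [hη]; push_cast; field_simp
    have earg : ((π / (2 * η) : ℝ) : ℂ) * ((σ : ℂ) + t * I - ρ) = ((π / 5 : ℝ) : ℂ) * z := by
      rw [ecoef, hz]; push_cast; field_simp
    have hzre : 0.6421 ≤ z.re := by
      rw [hz, Complex.div_ofReal_re]
      simp only [Complex.sub_re, Complex.add_re, Complex.ofReal_re, Complex.mul_re, Complex.I_re,
        mul_zero, Complex.ofReal_im, Complex.I_im, mul_one, sub_self, add_zero]
      rw [hσ, le_div_iff₀ hR]; nlinarith
    have hznorm : ‖z - 0.6421‖ ≤ 1 := by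
      have e : z - 0.6421 = (1 + t * I - ρ) / (R : ℂ) := by
        rw [hz, hσ]; push_cast; field_simp; ring
      rw [e, norm_div, Complex.norm_real, Real.norm_eq_abs, abs_of_pos hR, div_le_one hR]
      exact hρ.2
    have hc := hcot z hzre hznorm
    rw [earg, ecoef, mul_assoc, Complex.re_ofReal_mul]
    rw [div_eq_mul_inv, mul_comm, ← one_div]
    exact mul_le_mul_of_nonneg_left hc (by positivity)
  have hsum : 0.3758 / R * fordN t R ≤ ∑ ρ ∈ fordNearZeros t R, (riemannZetaZeroOrder ρ : ℝ) *
      ((((π / (2 * η) : ℝ) : ℂ) * Complex.cot (((π / (2 * η) : ℝ) : ℂ) * (σ + t * I - ρ))).re) := by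
    unfold fordN
    rw [Finset.mul_sum]
    refine Finset.sum_le_sum fun ρ hρ ↦ ?_
    have hm : (0 : ℝ) ≤ riemannZetaZeroOrder ρ := by
      have hz := (mem_fordNearZeros.1 hρ).1
      exact_mod_cast riemannZetaZeroOrder_nonneg fun h1 ↦ riemannZeta_one_ne_zero (h1 ▸ hz)
    rw [mul_comm]
    exact mul_le_mul_of_nonneg_left (hcotρ ρ hρ) hm
  -- (iii) the integral term
  have hση : σ + η = 1 + 3.1421 * R := by rw [hσ, hη]; ring
  have hint : -(1 / (4 * η) * fordLogZetaIntegral (σ + η) t (2 * η / π))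
      ≤ 1 / (2 * η) * (-Real.log R - 0.6903) := by
    have h1 := fordLogZetaIntegral_ge (σ' := σ + η) (by rw [hση]; linarith) t (2 * η / π)
    rw [hση] at h1 ⊢
    have h2 := log_zeta_ramare_bound hR hR4
    have h4η : 0 < 1 / (4 * η) := by positivity
    have e : 1 / (2 * η) = 2 * (1 / (4 * η)) := by field_simp; ring
    rw [e]
    nlinarith
  -- (iv) the Richert term: `(1 − σ + η)^{3/2} = (1.8579R)^{3/2} ≤ 2.5325 R^{3/2}`
  have hrich : 1 - σ + η = 1.8579 * R := by rw [hσ, hη]; ring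
  have hpow : (1 - σ + η) ^ (3 / 2 : ℝ) ≤ 2.5325 * R ^ (3 / 2 : ℝ) := by
    rw [hrich, Real.mul_rpow (by norm_num) hR.le]
    refine mul_le_mul_of_nonneg_right ?_ (by positivity)
    have e : (1.8579 : ℝ) ^ (3 / 2 : ℝ) = 1.8579 * Real.sqrt 1.8579 := by
      rw [show (3 / 2 : ℝ) = 1 + 1 / 2 by norm_num, Real.rpow_add (by norm_num), Real.rpow_one,
        Real.sqrt_eq_rpow]
    rw [e]
    have hs : Real.sqrt 1.8579 ≤ 1.36305 := by
      rw [Real.sqrt_le_left (by norm_num)]; norm_num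
    nlinarith [Real.sqrt_nonneg 1.8579]
  -- assemble: `0.3758 N/R ≤ 1/(0.6421R) + (1/(5R))(2/3 LL + 2.5325 B R^{3/2} L + log A − log R − 0.6903)`
  have hL : 0 ≤ Real.log t := Real.log_nonneg (by linarith)
  have h2η : 1 / (2 * η) = 1 / (5 * R) := by rw [hη]; ring
  have hkey : 0.3758 / R * fordN t R ≤ 1 / (0.6421 * R)
      + 1 / (5 * R) * (2 / 3 * Real.log (Real.log t) + B * (2.5325 * R ^ (3 / 2 : ℝ)) * Real.log t + Real.log A)
      + 1 / (5 * R) * (-Real.log R - 0.6903) := by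
    have hBt : B * (1 - σ + η) ^ (3 / 2 : ℝ) * Real.log t ≤ B * (2.5325 * R ^ (3 / 2 : ℝ)) * Real.log t :=
      mul_le_mul_of_nonneg_right (mul_le_mul_of_nonneg_left hpow hB) hL
    have h5R : 0 < 1 / (5 * R) := by positivity
    rw [h2η] at h hint
    nlinarith [h, hlhs, hsum, hint, hBt, h5R]
  -- divide by `0.3758/R`
  have hN0 := fordN_nonneg t R
  have hR32 : 0 ≤ R ^ (3 / 2 : ℝ) := by positivity
  have e : (1 / (0.6421 * R)
      + 1 / (5 * R) * (2 / 3 * Real.log (Real.log t) + B * (2.5325 * R ^ (3 / 2 : ℝ)) * Real.log t + Real.log A)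
      + 1 / (5 * R) * (-Real.log R - 0.6903)) * (R / 0.3758)
      = (1 / 0.6421 - 0.6903 / 5) / 0.3758
        + (2.5325 / (5 * 0.3758)) * R ^ (3 / 2 : ℝ) * B * Real.log t
        + (Real.log A - Real.log R + 2 / 3 * Real.log (Real.log t)) / (5 * 0.3758) := by
    field_simp; ring
  have hmul := mul_le_mul_of_nonneg_right hkey (show (0 : ℝ) ≤ R / 0.3758 by positivity)
  rw [e, show 0.3758 / R * fordN t R * (R / 0.3758) = fordN t R by field_simp] at hmul
  have hc1 : (1 / 0.6421 - 0.6903 / 5) / 0.3758 ≤ (3.777 : ℝ) := by norm_num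
  have hc2 : 2.5325 / (5 * 0.3758) * R ^ (3 / 2 : ℝ) * B * Real.log t ≤ 1.3478 * R ^ (3 / 2 : ℝ) * B * Real.log t := by
    have : 0 ≤ R ^ (3 / 2 : ℝ) * B * Real.log t := by positivity
    have hc : (2.5325 / (5 * 0.3758) : ℝ) ≤ 1.3478 := by norm_num
    nlinarith
  have hc3 : (Real.log A - Real.log R + 2 / 3 * Real.log (Real.log t)) / (5 * 0.3758)
      = (Real.log A - Real.log R + 2 / 3 * Real.log (Real.log t)) / 1.879 := by norm_num
  linarith
end Literature.NumberTheory.LFunctions
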